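/-
Copyright (c) 2026 the pub-hodgecm-mathlib formalisation cell (harness21).  Prover seat hodgecm-mathlib-K2E4-p14 (g9), Track B ∕ K2-LIT, h413 = `stmt-HodgeConjecture-24833`,
route of record `HCCMUnconditional`, RUNG 1 (M1 atoms); dealer K2E1-plan (g7) deals (262)∕(263): THE CM RUNG-1 PRINT — atoms at the trivial `K_∞`-type and level `K_max,f`
⟹ the `K_∞·K_max,f`-invariants of `L²_res(U(1,1)_{L∕L⁺})` are finite-dimensional (hypothesis-first on K2E4-p23's M1-atoms head shape).
-/
import Summits.HodgeConjecture.HodgeConjecture.Theorems.K2E1ResidualLevelFiniteOfAtomsU   -- ★ p860390 (this seat): `mem_of_mem_topologicalClosure_biSup`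
import Literature.NumberTheory.Automorphic.UnitaryGroupRestrictedProduct                   -- ★ `finAdelic`, `finAdelicToAdelic`
import Literature.NumberTheory.Automorphic.UnitaryGroupArchimedean                         -- ★ `arch`, `archToAdelic`
import HarnessLib

/-!
# h413 ∕ Track B «K2-LIT», RUNG 1 — `K2E1ResidualSphericalFiniteMaximalLevelCMTwo`: ATOMS AT `(1, K_max,f)` ⟹ `(L²_res)^{K_∞·K_max,f}` IS FINITE-DIMENSIONAL — generic `𝒢` in the
# `invariants` currency, and the `U(1,1)_{L∕L⁺}` print (hypothesis-first on the M1-atoms head of K2E4-p23's `K2E1ResidualAtomsMaximalLevelCMTwo`)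

Cell `pub/hodgecm-mathlib`, crux H413 = `stmt-HodgeConjecture-24833`; dealer K2E1-plan (g7) (262)∕(263).  THEOREMS ONLY (no `def`, no `instance`, no `notation`, no named-fact
hypothesis, no `sorry`); lane `--kind proof --supports stmt-HodgeConjecture-24833 --as helper` (count-neutral, closes no socket).

THE MATHEMATICS [MoeglinWaldspurger1995, I.2.18, V.3.13] [HarishChandra1968, Thm. 1] [BorelJacquet1979, §4.6] [Dixmier1977, §13.1].  ATOMS at the `K`-type `(1, K′)`: a continuous
linear `P` on `L²(G(F)∖G(𝔸))` fixing every vector invariant under `ι_f(K′)` and under `ι_a(K_c)` (in print `P = R(e_{K_c} ⊗ e_{K′})`), and a finite-dimensional `A` with `P(W) ⊆ A` for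
every topologically irreducible closed `W ≤ L²_res`.  Since `L²_res` is the closed span of those `W` (★ `residualSubspace_eq_iSupClosure`), `P(L²_res) ⊆ closure A = A` (★
`mem_of_mem_topologicalClosure_biSup`); an invariant vector of `L²_res` is fixed by `P`, so `L²_res ⊓ L²^{ι_f K′} ⊓ L²^{ι_a K_c} ≤ A` is finite-dimensional
(`Submodule.finiteDimensional_of_le`).  §1 generic `𝒢` (Mathlib `ContRepresentation.invariants` ∕ `restrict` currency); §2 the print for `U(1,1)_{L∕L⁺} = quasiSplit L⁺ L c 2`
with `ι_f = finAdelicToAdelic`, `ι_a = archToAdelic ∘ κ` (`κ : K_c →* U(1,1)(F_∞)`), `K′ ≤ U(1,1)(𝔸_f)` — RUNG 1 «`(L²_res(U(1,1)))^{K_∞·K_max,f}` finite-dimensional» BY NAME once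
K2E4-p23's M1-atoms head (`hatoms₀` below, ∀𝔓-guarded) is ★ at `(κ, K′) = (K_∞ ↪, K_max,f)`.
HONEST LABEL: HC_CM is proved only modulo the 7 printed citations (2 remaining named inputs: hLiu418 = `stmt-HodgeConjecture-24832`, h413 = `stmt-HodgeConjecture-24833`) until rung 0
closes; RUNG 1 (M1 atoms) ≠ 5Res (all `(U, τ)`); count-neutral helper, conditional by construction on `hatoms₀`, asserts no named fact, closes no socket.

## References
* [MoeglinWaldspurger1995] C. Mœglin, J.-L. Waldspurger, *Spectral Decomposition and Eisenstein Series* (1995), I.2.18, V.3.13.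
* [HarishChandra1968] Harish-Chandra, *Automorphic Forms on Semisimple Lie Groups*, LNM 62 (1968), Thm. 1.
* [BorelJacquet1979] A. Borel, H. Jacquet, *Automorphic forms and automorphic representations*, Corvallis I (1979), §4.6.
* [Dixmier1977] J. Dixmier, *C\*-Algebras* (1977), §13.1.
-/

set_option autoImplicit false
-- the mandated namespace repeats the single-problem summit's segment (`HodgeConjecture.HodgeConjecture`)
set_option linter.dupNamespace false

noncomputable section

open MeasureTheory Filter Topology Set NumberField
open Literature.NumberTheory.Automorphic Literature.NumberTheory.Automorphic.UnitaryGroup ContRepresentation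
open Summit.HodgeConjecture.HodgeConjecture.Cruxes.H413.K2E1CuspidalSpectrumUnitary
open Summit.HodgeConjecture.HodgeConjecture.Cruxes.H413.K2E1ResidualPartSpanIrreduciblesU (residualSubspace_eq_iSupClosure)
open Summit.HodgeConjecture.HodgeConjecture.Cruxes.H413.K2E1ResidualLevelFiniteOfAtomsU (mem_of_mem_topologicalClosure_biSup)

namespace Summit.HodgeConjecture.HodgeConjecture.Cruxes.H413.K2E1ResidualSphericalFiniteMaximalLevelCMTwo

universe u

/-! ## §1 Generic `𝒢`: atoms at `(1, K′)` ⟹ `L²_res ⊓ L²^{ι_f K′} ⊓ L²^{ι_a K_c}` is finite-dimensional -/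

section Generic

variable {F : Type} [Field F] [NumberField F] (𝒢 : AdelicGroupData.{u} F) (μ : Measure 𝒢.automorphicQuotient) [𝒢.IsAutomorphicMeasure μ]
  (𝔓 : 𝒢.ParabolicUnipotentData)

/-- **ATOMS AT `(1, K′)` ⟹ THE `(ι_a K_c · ι_f K′)`-INVARIANTS OF `L²_res` ARE FINITE-DIMENSIONAL** (generic `𝒢`, `invariants` currency).  `hatoms₀` is K2E4-p23's M1-atoms head
shape: `∃ P A, dim A < ∞ ∧ (P` fixes every `x` with `R(ι_f u) x = x` (`u ∈ K′`) and `R(ι_a k) x = x`) ∧ (P` maps every irreducible closed `W ≤ L²_res` into `A)`; CONCLUSION: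
`L²_res ⊓ (R ∘ ι_f|_{K′}).invariants ⊓ (R ∘ ι_a).invariants` is finite-dimensional (it is `≤ A`). [cite: MoeglinWaldspurger1995, I.2.18 and V.3.13] [cite: HarishChandra1968, Thm. 1] -/
theorem residual_invariants_finiteDimensional_of_atoms
    {Kc : Type*} [Group Kc] (ιa : Kc →* 𝒢.Adelic) {Kf : Type*} [Group Kf] (ιf : Kf →* 𝒢.Adelic) (K' : Subgroup Kf)
    (hatoms₀ : ∃ (P : 𝒢.L2 μ →L[ℂ] 𝒢.L2 μ) (A : Submodule ℂ (𝒢.L2 μ)), FiniteDimensional ℂ A ∧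
      (∀ x : 𝒢.L2 μ, (∀ u ∈ K', 𝒢.rightRegular μ (ιf u) x = x) → (∀ k : Kc, 𝒢.rightRegular μ (ιa k) x = x) → P x = x) ∧
      ∀ W : ClosedSubrep (𝒢.rightRegular μ), W.toContRep.IsTopIrreducible → W ≤ residualSubspace 𝒢 μ 𝔓 → ∀ w ∈ W, P w ∈ A) :
    FiniteDimensional ℂ ↥((residualSubspace 𝒢 μ 𝔓).toSubmodule ⊓ ((𝒢.rightRegular μ).restrict (ιf.comp K'.subtype)).invariants ⊓
      ((𝒢.rightRegular μ).restrict ιa).invariants) := by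
  obtain ⟨P, A, hAfd, hPfix, hPW⟩ := hatoms₀
  haveI := hAfd
  refine Submodule.finiteDimensional_of_le (fun x hx => ?_ :
    (residualSubspace 𝒢 μ 𝔓).toSubmodule ⊓ ((𝒢.rightRegular μ).restrict (ιf.comp K'.subtype)).invariants ⊓ ((𝒢.rightRegular μ).restrict ιa).invariants ≤ A)
  obtain ⟨hx₁, ha⟩ := Submodule.mem_inf.1 hx
  obtain ⟨hres, hf⟩ := Submodule.mem_inf.1 hx₁
  have h1 : ∀ u ∈ K', 𝒢.rightRegular μ (ιf u) x = x := fun u hu => (ContRepresentation.mem_invariants x).1 hf ⟨u, hu⟩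
  have h2 : ∀ k : Kc, 𝒢.rightRegular μ (ιa k) x = x := fun k => (ContRepresentation.mem_invariants x).1 ha k
  have hPx : P x = x := hPfix x h1 h2
  -- the irreducible `W ⊥ L²_cusp` lie in `L²_res` (★ D5′-pre), so `P` maps them into `A`
  have hPW' : ∀ W ∈ {W : ClosedSubrep (𝒢.rightRegular μ) | W.toContRep.IsTopIrreducible ∧ W ≤ (𝒢.cuspidalSubspace μ 𝔓).orthogonal (𝒢.isUnitary_rightRegular μ)},
      ∀ w ∈ W.toSubmodule, P w ∈ A := fun W hW w hw =>
    hPW W hW.1 (by rw [residualSubspace_eq_iSupClosure]; exact ClosedSubrep.le_iSupClosure hW) w hw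
  have hxres : x ∈ ClosedSubrep.iSupClosure {W : ClosedSubrep (𝒢.rightRegular μ) |
      W.toContRep.IsTopIrreducible ∧ W ≤ (𝒢.cuspidalSubspace μ 𝔓).orthogonal (𝒢.isUnitary_rightRegular μ)} :=
    (residualSubspace_eq_iSupClosure 𝒢 μ 𝔓).le hres
  exact mem_of_mem_topologicalClosure_biSup {W : ClosedSubrep (𝒢.rightRegular μ) | W.toContRep.IsTopIrreducible ∧ W ≤ (𝒢.cuspidalSubspace μ 𝔓).orthogonal (𝒢.isUnitary_rightRegular μ)}
    (fun W => W.toSubmodule) P A hPW' hxres hPx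

end Generic

/-! ## §2 The `U(1,1)_{L∕L⁺}` print (hypothesis-first on K2E4-p23's M1-atoms head) -/

section CM

variable (L : Type) [Field L] [NumberField L] [IsCMField L]
  (μ : Measure (quasiSplit (↥(maximalRealSubfield L)) L (IsCMField.complexConj L) 2).automorphicQuotient)
  [(quasiSplit (↥(maximalRealSubfield L)) L (IsCMField.complexConj L) 2).IsAutomorphicMeasure μ]
  (𝔓 : (quasiSplit (↥(maximalRealSubfield L)) L (IsCMField.complexConj L) 2).ParabolicUnipotentData)

/-- **RUNG 1 SHAPE FOR `U(1,1)_{L∕L⁺}` — ATOMS AT `(1, K′)` ⟹ `(L²_res)^{ι_∞κ(K_c)·ι_f(K′)}` FINITE-DIMENSIONAL** (∀𝔓-guarded; `ι_f = finAdelicToAdelic`, `ι_∞ = archToAdelic`,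
`κ : K_c →* U(1,1)(F_∞)`, `K′ ≤ U(1,1)(𝔸_f)`): §1 at `𝒢 := quasiSplit L⁺ L c 2` (`= cmDatum L 2 J₂`).  With `hatoms₀ :=` K2E4-p23's M1-atoms head at `(κ, K′) = (K_∞ ↪, K_max,f)` and
`𝔓` the Borel datum this is «`(L²_res(U(1,1)_{L∕L⁺}))^{K_∞·K_max,f}` is finite-dimensional» BY NAME. [cite: MoeglinWaldspurger1995, I.2.18 and V.3.13] [cite: HarishChandra1968, Thm. 1]
[cite: BorelJacquet1979, §4.6] -/
theorem residual_invariants_finiteDimensional_of_atoms_cm_two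
    {Kc : Type*} [Group Kc] (κ : Kc →* arch (↥(maximalRealSubfield L)) L (IsCMField.complexConj L) 2 ((StdForm.antidiagonal 2).over L))
    (K' : Subgroup (finAdelic (↥(maximalRealSubfield L)) L (IsCMField.complexConj L) 2 ((StdForm.antidiagonal 2).over L)))
    (hatoms₀ : ∃ (P : (quasiSplit (↥(maximalRealSubfield L)) L (IsCMField.complexConj L) 2).L2 μ →L[ℂ] (quasiSplit (↥(maximalRealSubfield L)) L (IsCMField.complexConj L) 2).L2 μ)
        (A : Submodule ℂ ((quasiSplit (↥(maximalRealSubfield L)) L (IsCMField.complexConj L) 2).L2 μ)), FiniteDimensional ℂ A ∧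
      (∀ x : (quasiSplit (↥(maximalRealSubfield L)) L (IsCMField.complexConj L) 2).L2 μ,
        (∀ u ∈ K', (quasiSplit (↥(maximalRealSubfield L)) L (IsCMField.complexConj L) 2).rightRegular μ (finAdelicToAdelic (↥(maximalRealSubfield L)) L (IsCMField.complexConj L) 2 ((StdForm.antidiagonal 2).over L) u) x = x) →
        (∀ k : Kc, (quasiSplit (↥(maximalRealSubfield L)) L (IsCMField.complexConj L) 2).rightRegular μ (archToAdelic (↥(maximalRealSubfield L)) L (IsCMField.complexConj L) 2 ((StdForm.antidiagonal 2).over L) (κ k)) x = x) → P x = x) ∧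
      ∀ W : ClosedSubrep ((quasiSplit (↥(maximalRealSubfield L)) L (IsCMField.complexConj L) 2).rightRegular μ), W.toContRep.IsTopIrreducible →
        W ≤ residualSubspace (quasiSplit (↥(maximalRealSubfield L)) L (IsCMField.complexConj L) 2) μ 𝔓 → ∀ w ∈ W, P w ∈ A) :
    FiniteDimensional ℂ ↥((residualSubspace (quasiSplit (↥(maximalRealSubfield L)) L (IsCMField.complexConj L) 2) μ 𝔓).toSubmodule ⊓
      (((quasiSplit (↥(maximalRealSubfield L)) L (IsCMField.complexConj L) 2).rightRegular μ).restrict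
        ((finAdelicToAdelic (↥(maximalRealSubfield L)) L (IsCMField.complexConj L) 2 ((StdForm.antidiagonal 2).over L)).comp K'.subtype)).invariants ⊓
      (((quasiSplit (↥(maximalRealSubfield L)) L (IsCMField.complexConj L) 2).rightRegular μ).restrict
        ((archToAdelic (↥(maximalRealSubfield L)) L (IsCMField.complexConj L) 2 ((StdForm.antidiagonal 2).over L)).comp κ)).invariants) :=
  residual_invariants_finiteDimensional_of_atoms _ μ 𝔓 ((archToAdelic (↥(maximalRealSubfield L)) L (IsCMField.complexConj L) 2 ((StdForm.antidiagonal 2).over L)).comp κ)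
    (finAdelicToAdelic (↥(maximalRealSubfield L)) L (IsCMField.complexConj L) 2 ((StdForm.antidiagonal 2).over L)) K' hatoms₀

end CM

end Summit.HodgeConjecture.HodgeConjecture.Cruxes.H413.K2E1ResidualSphericalFiniteMaximalLevelCMTwo

end
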